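import Literature.Analysis.FluidPDE.CaloricDualTestFields
import HarnessLib

/-!
# Pairings of data with caloric test fields against the parabolic Riesz potentials

Analysis/FluidPDE support file (everything proved) for the discharge of the named fact
`Literature.Analysis.FluidPDE.LemarieRieusset2016.step3_velocityBound`
(`CKNMorreyRepresentation.lean`; Lemarié-Rieusset 2016, §13.9 Step 3, (13.50)–(13.52),
pp. 474–475). In the duality proof of (13.52) (`CKNMorreyDualIdentity.lean`) every term is a
pairing `∫ data · X` of a data function (cut-off × monomial in `u`, `p` or `f`) with a caloric
test field `X` (`η = 𝒰_ν[g]`, `∂η`, `Ξ = 𝒰_ν[∂_c N g]`, `∂Ξ`, `∂²Ξ`, `L`), and the fields are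
dominated pointwise by parabolic kernels of `|g|` (`CaloricDualTestFields.lean`:
`‖X(s,y)‖ ≤ C ∫ δ₂((s,y),w)^{-(5-α)} |g(w)| dw`, `α = 2, 1`, or `≤ B ‖g‖₁` off the diagonal). This
file performs the passage, by Tonelli, from such pointwise bounds to bounds of the pairings by
the parabolic Riesz potentials `𝓘_α` (`parabolicRieszPotential`, Lemarié-Rieusset 2016, Thm. 5.3)
of the data:

* `lintegral_mul_le_of_le_kernel` — if `P(z) ≤ C ∫ δ₂(z, w)^{-e} Θₙ(w) dw + M` wherever
  `Dat(z) ≠ 0`, then `∫ Dat · P ≤ C ∫ Θₙ(w) (∫ Dat(z) δ₂(w, z)^{-e} dz) dw + M ∫ Dat`;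
  `lintegral_mul_le_of_le_const` — the bounded case;
* the Riesz potentials with integer kernel exponents (`parabolicRieszPotential_two_eq`,
  `parabolicRieszPotential_one_eq`);
* the assembled pairing bounds: `∫ Dat |η| ≤ C ∫ |g| 𝓘₂(Dat)`, `∫ Dat |∂ᵥη| ≤ C ∫ |g| 𝓘₁(Dat)`,
  and `∫ Dat |∂ᵤ∂ᵥΞ| ≤ C ∫ |g| 𝓘₁(Dat)` when the data see the support of `g` within a bounded
  parabolic range.

## References

* P. G. Lemarié-Rieusset, *The Navier–Stokes Problem in the 21st Century*, CRC Press (2016),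
  Thm. 5.3 (p. 110), §13.9 Step 3, (13.50)–(13.52), pp. 474–475. [LemarieRieusset2016]
-/

noncomputable section

open MeasureTheory Set Function Filter Topology Metric Real
open scoped ENNReal NNReal RealInnerProductSpace

namespace Literature.Analysis.FluidPDE

/-! ### Tonelli against a parabolic kernel -/

section Tonelli

/-- The parabolic kernel `(z, w) ↦ (ofReal δ₂(z, w))^{-e}` is measurable. [folklore] -/
theorem measurable_parabolicKernel_rpow (e : ℝ) :
    Measurable fun p : (ℝ × EuclideanSpace ℝ (Fin 3)) × (ℝ × EuclideanSpace ℝ (Fin 3)) =>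
      (ENNReal.ofReal (parabolicDist p.1 p.2) ^ e)⁻¹ :=
  ((ENNReal.measurable_ofReal.comp continuous_parabolicDist.measurable).pow_const _).inv

/-- **Tonelli against a parabolic kernel**: let `Dat, Θₙ ≥ 0` be a.e.-measurable on `ℝ × ℝ³`,
`e` a real exponent, and suppose `P(z) ≤ C ∫ (ofReal δ₂(z, w))^{-e} Θₙ(w) dw + M` wherever
`Dat(z) ≠ 0`. Then
`∫ Dat(z) P(z) dz ≤ C ∫ Θₙ(w) (∫ Dat(z) (ofReal δ₂(w, z))^{-e} dz) dw + M ∫ Dat`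
(Tonelli and the symmetry of `δ₂`). [folklore] -/
theorem lintegral_mul_le_of_le_kernel {Dat P Θn : ℝ × EuclideanSpace ℝ (Fin 3) → ℝ≥0∞}
    {e : ℝ} {C M : ℝ≥0∞} (hDat : AEMeasurable Dat volume) (hΘn : AEMeasurable Θn volume)
    (hP : ∀ z, Dat z ≠ 0 →
      P z ≤ C * (∫⁻ w, (ENNReal.ofReal (parabolicDist z w) ^ e)⁻¹ * Θn w) + M) :
    ∫⁻ z, Dat z * P z ≤
      C * (∫⁻ w, Θn w * ∫⁻ z, Dat z * (ENNReal.ofReal (parabolicDist w z) ^ e)⁻¹) +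
        M * ∫⁻ z, Dat z := by
  set K : (ℝ × EuclideanSpace ℝ (Fin 3)) × (ℝ × EuclideanSpace ℝ (Fin 3)) → ℝ≥0∞ :=
    fun p => (ENNReal.ofReal (parabolicDist p.1 p.2) ^ e)⁻¹ with hK
  have hKm : Measurable K := measurable_parabolicKernel_rpow e
  have hKsymm : ∀ z w, K (z, w) = K (w, z) := fun z w => by
    simp only [hK, parabolicDist_comm z w]
  -- pointwise
  have hpt : ∀ z, Dat z * P z ≤ Dat z * (C * ∫⁻ w, K (z, w) * Θn w) + Dat z * M := by
    intro z
    by_cases hz : Dat z = 0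
    · simp [hz]
    · rw [← mul_add]; exact mul_le_mul_right (hP z hz) _
  -- the joint integrand
  have hF : AEMeasurable (fun p : (ℝ × EuclideanSpace ℝ (Fin 3)) × (ℝ × EuclideanSpace ℝ (Fin 3)) =>
      Dat p.1 * (K (p.1, p.2) * Θn p.2)) (volume.prod volume) :=
    (hDat.comp_quasiMeasurePreserving Measure.quasiMeasurePreserving_fst).mul
      (hKm.aemeasurable.mul (hΘn.comp_quasiMeasurePreserving Measure.quasiMeasurePreserving_snd))
  have hmain : ∫⁻ z, Dat z * (C * ∫⁻ w, K (z, w) * Θn w) =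
      C * ∫⁻ w, Θn w * ∫⁻ z, Dat z * K (w, z) := by
    calc ∫⁻ z, Dat z * (C * ∫⁻ w, K (z, w) * Θn w)
        = ∫⁻ z, C * ∫⁻ w, Dat z * (K (z, w) * Θn w) := by
          refine lintegral_congr fun z => ?_
          have hm : AEMeasurable (fun w : ℝ × EuclideanSpace ℝ (Fin 3) => K (z, w) * Θn w) volume :=
            (hKm.comp (measurable_const.prodMk measurable_id)).aemeasurable.mul hΘn
          rw [lintegral_const_mul'' (Dat z) hm]
          ring
      _ = C * ∫⁻ z, ∫⁻ w, Dat z * (K (z, w) * Θn w) :=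
          lintegral_const_mul'' _ hF.lintegral_prod_right'
      _ = C * ∫⁻ w, ∫⁻ z, Dat z * (K (z, w) * Θn w) := by rw [lintegral_lintegral_swap hF]
      _ = C * ∫⁻ w, Θn w * ∫⁻ z, Dat z * K (w, z) := by
          congr 1; refine lintegral_congr fun w => ?_
          have hm : AEMeasurable (fun z : ℝ × EuclideanSpace ℝ (Fin 3) => Dat z * K (w, z)) volume :=
            hDat.mul (hKm.comp (measurable_const.prodMk measurable_id)).aemeasurable
          rw [← lintegral_const_mul'' (Θn w) hm]
          refine lintegral_congr fun z => ?_
          rw [hKsymm z w]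
          ring
  calc ∫⁻ z, Dat z * P z ≤ ∫⁻ z, (Dat z * (C * ∫⁻ w, K (z, w) * Θn w) + Dat z * M) :=
        lintegral_mono hpt
    _ = (∫⁻ z, Dat z * (C * ∫⁻ w, K (z, w) * Θn w)) + ∫⁻ z, Dat z * M :=
        lintegral_add_right' _ (hDat.mul_const M)
    _ = C * (∫⁻ w, Θn w * ∫⁻ z, Dat z * K (w, z)) + M * ∫⁻ z, Dat z := by
        rw [hmain, lintegral_mul_const'' _ hDat, mul_comm _ M]

/-- **Bounded fields**: if `P(z) ≤ M` wherever `Dat(z) ≠ 0`, then `∫ Dat · P ≤ M ∫ Dat`.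
[folklore] -/
theorem lintegral_mul_le_of_le_const {X : Type*} [MeasurableSpace X] {μ : Measure X}
    {Dat P : X → ℝ≥0∞} {M : ℝ≥0∞} (hDat : AEMeasurable Dat μ) (hP : ∀ z, Dat z ≠ 0 → P z ≤ M) :
    ∫⁻ z, Dat z * P z ∂μ ≤ M * ∫⁻ z, Dat z ∂μ := by
  have hpt : ∀ z, Dat z * P z ≤ M * Dat z := by
    intro z
    by_cases hz : Dat z = 0
    · simp [hz]
    · rw [mul_comm]; exact mul_le_mul_left (hP z hz) _
  calc ∫⁻ z, Dat z * P z ∂μ ≤ ∫⁻ z, M * Dat z ∂μ := lintegral_mono hpt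
    _ = M * ∫⁻ z, Dat z ∂μ := lintegral_const_mul'' _ hDat

/-- The Riesz potential `𝓘₂` with the kernel exponent written as `3`. [folklore] -/
theorem parabolicRieszPotential_two_eq (Φ : ℝ × EuclideanSpace ℝ (Fin 3) → ℝ≥0∞)
    (z : ℝ × EuclideanSpace ℝ (Fin 3)) :
    parabolicRieszPotential 2 Φ z = ∫⁻ w, Φ w * (ENNReal.ofReal (parabolicDist z w) ^ (3 : ℝ))⁻¹ := by
  rw [parabolicRieszPotential, show (5 : ℝ) - 2 = 3 by norm_num]

/-- The Riesz potential `𝓘₁` with the kernel exponent written as `4`. [folklore] -/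
theorem parabolicRieszPotential_one_eq (Φ : ℝ × EuclideanSpace ℝ (Fin 3) → ℝ≥0∞)
    (z : ℝ × EuclideanSpace ℝ (Fin 3)) :
    parabolicRieszPotential 1 Φ z = ∫⁻ w, Φ w * (ENNReal.ofReal (parabolicDist z w) ^ (4 : ℝ))⁻¹ := by
  rw [parabolicRieszPotential, show (5 : ℝ) - 1 = 4 by norm_num]

/-- The size `‖g‖` of a scalar space–time test function is (a.e.-)measurable. [folklore] -/
theorem IsSpaceTimeTestOn.aemeasurable_enorm_uncurry {g : ℝ → EuclideanSpace ℝ (Fin 3) → ℝ}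
    (hg : IsSpaceTimeTestOn (⊤ : TopologicalSpace.Opens (ℝ × EuclideanSpace ℝ (Fin 3))) g) :
    AEMeasurable (fun w : ℝ × EuclideanSpace ℝ (Fin 3) => ‖g w.1 w.2‖ₑ) volume :=
  (hg.contDiff.continuous.measurable.enorm).aemeasurable

end Tonelli

/-! ### The pairing bounds -/

section Pairings

variable {ν : ℝ} {r₀ r₁ : ℝ}

/-- **`∫ Dat |η| ≤ C ∫ |g| 𝓘₂(Dat)`** for the heat potential `η = 𝒰_ν[g]` of a scalar space–time
test function `g` and a.e.-measurable data `Dat ≥ 0` (the term `𝓘₂(|g⃗|)` of (13.52): kernel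
`|W_{νt}| ≤ C δ₂⁻³`, Lemarié-Rieusset 2016, p. 475; `C = C(ν)`). [cite: LemarieRieusset2016, §13.9 Step 3 (13.52) p. 475] -/
theorem exists_lintegral_mul_enorm_eta_le (hν : 0 < ν) :
    ∃ C : ℝ, 0 ≤ C ∧ ∀ (g : ℝ → EuclideanSpace ℝ (Fin 3) → ℝ),
      IsSpaceTimeTestOn (⊤ : TopologicalSpace.Opens (ℝ × EuclideanSpace ℝ (Fin 3))) g →
      ∀ (Dat : ℝ × EuclideanSpace ℝ (Fin 3) → ℝ≥0∞), AEMeasurable Dat volume →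
        ∫⁻ z, Dat z * ‖heatDuhamelBack ν g z.1 z.2‖ₑ ≤
          ENNReal.ofReal C *
            ∫⁻ w : ℝ × EuclideanSpace ℝ (Fin 3), ‖g w.1 w.2‖ₑ * parabolicRieszPotential 2 Dat w := by
  obtain ⟨C, hC, h⟩ := exists_enorm_heatDuhamelBack_le_parabolic hν
  refine ⟨C, hC.le, fun g hg Dat hDat => ?_⟩
  have key := lintegral_mul_le_of_le_kernel (P := fun z => ‖heatDuhamelBack ν g z.1 z.2‖ₑ)
    (e := 3) (C := ENNReal.ofReal C) (M := 0) hDat hg.aemeasurable_enorm_uncurry (fun z _ => by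
      rw [add_zero]; exact h hg z.1 z.2)
  rw [zero_mul, add_zero] at key
  refine key.trans (le_of_eq ?_)
  congr 1
  refine lintegral_congr fun w => ?_
  rw [parabolicRieszPotential_two_eq]

/-- **`∫ Dat |∂ᵥη| ≤ C ∫ |g| 𝓘₁(Dat)`** for `‖v‖ ≤ 1` (the terms `𝓘₁(|h⃗ᵢ|)` of (13.52): kernel
`|∇W_{νt}| ≤ C δ₂⁻⁴`, Lemarié-Rieusset 2016, p. 475; `C = C(ν)`). [cite: LemarieRieusset2016, §13.9 Step 3 (13.52) p. 475] -/
theorem exists_lintegral_mul_enorm_fderiv_eta_le (hν : 0 < ν) :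
    ∃ C : ℝ, 0 ≤ C ∧ ∀ (g : ℝ → EuclideanSpace ℝ (Fin 3) → ℝ),
      IsSpaceTimeTestOn (⊤ : TopologicalSpace.Opens (ℝ × EuclideanSpace ℝ (Fin 3))) g →
      ∀ v : EuclideanSpace ℝ (Fin 3), ‖v‖ ≤ 1 →
      ∀ (Dat : ℝ × EuclideanSpace ℝ (Fin 3) → ℝ≥0∞), AEMeasurable Dat volume →
        ∫⁻ z, Dat z * ‖fderiv ℝ (heatDuhamelBack ν g z.1) z.2 v‖ₑ ≤
          ENNReal.ofReal C *
            ∫⁻ w : ℝ × EuclideanSpace ℝ (Fin 3), ‖g w.1 w.2‖ₑ * parabolicRieszPotential 1 Dat w := by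
  obtain ⟨C, hC, h⟩ := exists_enorm_fderiv_heatDuhamelBack_le_parabolic hν
  refine ⟨C, hC.le, fun g hg v hv Dat hDat => ?_⟩
  have key := lintegral_mul_le_of_le_kernel
    (P := fun z => ‖fderiv ℝ (heatDuhamelBack ν g z.1) z.2 v‖ₑ)
    (e := 4) (C := ENNReal.ofReal C) (M := 0) hDat hg.aemeasurable_enorm_uncurry (fun z _ => by
      rw [add_zero]; exact h hg z.1 z.2 v hv)
  rw [zero_mul, add_zero] at key
  refine key.trans (le_of_eq ?_)
  congr 1
  refine lintegral_congr fun w => ?_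
  rw [parabolicRieszPotential_one_eq]

/-- **`∫ Dat |∂ᵤ∂ᵥΞ| ≤ C ∫ |g| 𝓘₁(Dat)`** for `Ξ = 𝒰_ν[∂_c N g]`, unit-bounded `u, v, c`, when
from every point charged by `Dat` the support of `g` is seen at heat times `ν(t - s) ≤ A` and
distances `≤ R` (the term `𝓘₁(φ|uⱼuₗ|)` of (13.52): "the kernel of `e^{νtΔ}∇∂ⱼ∂ₗΔ⁻¹` is
`O(δ₂⁻⁴)`", Lemarié-Rieusset 2016, p. 475; `C = C(ν, r₀, r₁, A, R)`). [cite: LemarieRieusset2016, §13.9 Step 3 (13.52) p. 475] -/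
theorem exists_lintegral_mul_enorm_fderiv2_Xi_le (h₀ : 0 < r₀) (h₁ : r₀ < r₁) (hν : 0 < ν)
    {A R : ℝ} (hA : 0 < A) (hR : 0 < R) :
    ∃ C : ℝ, 0 ≤ C ∧ ∀ (g : ℝ → EuclideanSpace ℝ (Fin 3) → ℝ),
      IsSpaceTimeTestOn (⊤ : TopologicalSpace.Opens (ℝ × EuclideanSpace ℝ (Fin 3))) g →
      ∀ u v c : EuclideanSpace ℝ (Fin 3), ‖u‖ ≤ 1 → ‖v‖ ≤ 1 → ‖c‖ ≤ 1 →
      ∀ (Dat : ℝ × EuclideanSpace ℝ (Fin 3) → ℝ≥0∞), AEMeasurable Dat volume →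
        (∀ z, Dat z ≠ 0 → ∀ t x, g t x ≠ 0 → z.1 < t → ν * (t - z.1) ≤ A ∧ ‖z.2 - x‖ ≤ R) →
        ∫⁻ z, Dat z * ‖fderiv ℝ (fun y' => fderiv ℝ
            (heatDuhamelBack ν (fun t y => fderiv ℝ (newtonNearPotential r₀ r₁ (g t)) y c) z.1) y' v)
            z.2 u‖ₑ ≤
          ENNReal.ofReal C *
            ∫⁻ w : ℝ × EuclideanSpace ℝ (Fin 3), ‖g w.1 w.2‖ₑ * parabolicRieszPotential 1 Dat w := by
  obtain ⟨C, hC, h⟩ := exists_enorm_fderiv2_heatDuhamelBack_newton_le_parabolic h₀ h₁ hν hA hR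
  refine ⟨C, hC.le, fun g hg u v c hu hv hc Dat hDat hrange => ?_⟩
  have key := lintegral_mul_le_of_le_kernel
    (P := fun z => ‖fderiv ℝ (fun y' => fderiv ℝ
      (heatDuhamelBack ν (fun t y => fderiv ℝ (newtonNearPotential r₀ r₁ (g t)) y c) z.1) y' v) z.2 u‖ₑ)
    (e := 4) (C := ENNReal.ofReal C) (M := 0) hDat hg.aemeasurable_enorm_uncurry (fun z hz => by
      rw [add_zero]; exact h hg u v c hu hv hc z.1 z.2 (hrange z hz))
  rw [zero_mul, add_zero] at key
  refine key.trans (le_of_eq ?_)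
  congr 1
  refine lintegral_congr fun w => ?_
  rw [parabolicRieszPotential_one_eq]

end Pairings

end Literature.Analysis.FluidPDE
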